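import Summits.ABC.ABC.Theorems.SoloBlindCycloRad
import Literature.NumberTheory.DiophantineGeometry.SquarefulSums
import HarnessLib
import Literature.Uncategorized.ABCOnSquares

/-!
# abc is decided on Pythagorean triples, on triples of squares, and on powerful triples

Solo seat `solo-ABC-blind` (ideation tier, summit-directed), session 6.

**Theorems.**

* `abc_iff_abcOnSquares`:  `ABC ↔` abc restricted to abc triples `(x², y², z²)` of three squares,
  i.e. to primitive Pythagorean triples `x² + y² = z²` read as abc triples
  (`abc_iff_pythagorean`: `ABC ↔ ∀ ε > 0 ∃ C > 0, z² < C · rad(x y z)^{1+ε}` for all coprime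
  positive `x² + y² = z²`).
* `abc_iff_abcOnPowerful`:  `ABC ↔` abc restricted to abc triples in which `a`, `b` and `c` are all
  powerful (squareful) numbers — the triples on which the radical is smallest relative to the size
  (`rad(abc) ≤ (abc)^{1/2}`), and of which there are only `≍ B^{1/2}` up to height `B`
  (Browning–Van Valckenborgh 2012, `Literature…SquarefulSums`), against `≍ B²` abc triples.
* `abc_iff_cycloRadOdd`:  for every `n ≥ 1`, `ABC ↔` the Stewart-type lower bound
  `rad(u v (vⁿ − uⁿ)) ≥ κ_ε v^{n−ε}` for coprime `0 < u < v` OF OPPOSITE PARITY only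
  (sharpening `abc_iff_cycloRad`, where all coprime pairs were used).

**Mechanism** (a clean Belyi map: the Pythagorean parametrisation is the degree-4 identity
`(v² − u²)² + (2uv)² = (v² + u²)²` whose product has exactly `4 + 2` distinct linear factors
`u, v, v ± u, v ± iu`, three of them rational through `0, 1, ∞`).  Apply the restricted inequality
to the Pythagorean triple of squares built from a coprime pair `u < v` of opposite parity: its
radical is `rad(2 u v (v⁴ − u⁴)) ≤ 2 · rad(u v (v⁴ − u⁴))` and its largest member is
`(u² + v²)² ≥ v⁴`, so abc on squares gives `CycloRadOdd 4`; and `CycloRadOdd n → ABC` by evaluating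
at `(u, v) = (a, c)` or `(b, c)` — whichever has `b` resp. `a` odd — exactly as in
`SoloBlindCycloRad` (`vⁿ − uⁿ = (v − u) · m`, `m ≤ n vⁿ⁻¹`).  Powerful ⊇ squares gives the third
equivalence.  Exponent bookkeeping: abc with `1 + δ` on squares yields abc with
`(1 + δ)/(1 − 3δ)`-type exponents, which still exhaust `(1, ∞)`.

References: Oesterlé, Sém. Bourbaki 694 (1988) [Oesterle1988] (the `16 ∣ abc` reduction uses the
degree-2 identity `(a − b)² + 4ab = (a + b)²` in the same way); Browning–Van Valckenborgh,
Exp. Math. 21 (2012), arXiv:1106.4472 [BrowningValckenborgh2012]; Bombieri–Gubler (2006)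
Conj. 12.2.2 [BombieriGubler2006].
-/

noncomputable section

open UniqueFactorizationMonoid

namespace Summit.ABC.ABC.Theorems

open Literature.NumberTheory.DiophantineGeometry

/-! ### Statements -/

/-- `CycloRadOdd n`: the lower bound `κ · v^{n−ε} ≤ rad(u v (vⁿ − uⁿ))` of `CycloRad n`, asked only
for coprime `0 < u < v` of opposite parity (`u + v` odd). [folklore] -/
def CycloRadOdd (n : ℕ) : Prop :=
  ∀ ε : ℝ, 0 < ε → ∃ κ : ℝ, 0 < κ ∧ ∀ u v : ℕ, 0 < u → u < v → Nat.Coprime u v → Odd (u + v) →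
    κ * (v : ℝ) ^ ((n : ℝ) - ε) ≤ ((radical (u * v * (v ^ n - u ^ n)) : ℕ) : ℝ)

/-! ### `CycloRadOdd n → ABC` -/

/-- Transport of a parity-restricted radical lower bound for `u v (v^{k+1} − u^{k+1})` to ALL abc
triples: evaluate at `(a, c)` if `b` is odd, at `(b, c)` if `b` is even (then `a` is odd).
[folklore] -/
theorem abc_eval_odd (k : ℕ) {μ κ : ℝ}
    (H : ∀ u v : ℕ, 0 < u → u < v → Nat.Coprime u v → Odd (u + v) →
      κ * (v : ℝ) ^ μ ≤ ((radical (u * v * (v ^ (k + 1) - u ^ (k + 1))) : ℕ) : ℝ))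
    {a b c : ℕ} (h : IsABCTriple a b c) :
    κ * (c : ℝ) ^ μ ≤ ((k : ℝ) + 1) * (c : ℝ) ^ k * ((rad a b c : ℕ) : ℝ) := by
  obtain ⟨ha, hb, habc, hcop⟩ := h
  rcases Nat.even_or_odd b with hbe | hbo
  · -- `b` even, hence `a` odd: use the pair `(b, c)` and the triple `(b, a, c)`
    have hao : Odd a := by
      by_contra hne
      rw [Nat.not_odd_iff_even] at hne
      obtain ⟨x, hx⟩ := hne
      obtain ⟨y, hy⟩ := hbe
      have h2 : 2 ∣ Nat.gcd a b := Nat.dvd_gcd ⟨x, by omega⟩ ⟨y, by omega⟩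
      rw [hcop] at h2
      omega
    have hbc : b < c := by omega
    have hcopbc : Nat.Coprime b c := by
      rw [← habc, Nat.Coprime, Nat.gcd_add_self_right]; exact hcop.symm
    have hodd : Odd (b + c) := by
      rw [← habc, show b + (a + b) = a + 2 * b by ring]
      exact hao.add_even (even_two_mul b)
    have h' : IsABCTriple b a c := ⟨hb, ha, by omega, hcop.symm⟩
    have step := (H b c hb hbc hcopbc hodd).trans (radical_form_le b a c k h')
    have hrad : rad b a c = rad a b c := by rw [rad_def, rad_def, mul_comm b a]
    rwa [hrad] at step
  · -- `b` odd: use the pair `(a, c)`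
    have hac : a < c := by omega
    have hcopac : Nat.Coprime a c := by
      rw [← habc, Nat.Coprime, Nat.gcd_self_add_right]; exact hcop
    have hodd : Odd (a + c) := by
      rw [← habc, show a + (a + b) = b + 2 * a by ring]
      exact hbo.add_even (even_two_mul a)
    exact (H a c ha hac hcopac hodd).trans (radical_form_le a b c k ⟨ha, hb, habc, hcop⟩)

/-- From the evaluated inequality `κ c^{k+θ} ≤ (k+1) c^k rad(abc)` on all triples to
`PolyABC (1/θ)`. [folklore] -/
theorem polyABC_of_eval (k : ℕ) {θ κ : ℝ} (hθ : 0 < θ) (hκ : 0 < κ)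
    (key : ∀ a b c : ℕ, IsABCTriple a b c →
      κ * (c : ℝ) ^ ((k : ℝ) + θ) ≤ ((k : ℝ) + 1) * (c : ℝ) ^ k * ((rad a b c : ℕ) : ℝ)) :
    PolyABC (1 / θ) := by
  refine ⟨(((k : ℝ) + 1) / κ) ^ (1 / θ), by positivity, ?_⟩
  intro a b c h
  have key1 := key a b c h
  have hR := rad_cast_pos h
  obtain ⟨ha, hb, habc, -⟩ := h
  have hc0 : (0 : ℝ) < c := by exact_mod_cast (show 0 < c by omega)
  set R : ℝ := ((rad a b c : ℕ) : ℝ) with hRdef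
  have hsplit : (c : ℝ) ^ ((k : ℝ) + θ) = (c : ℝ) ^ k * (c : ℝ) ^ θ := by
    rw [Real.rpow_add hc0, Real.rpow_natCast]
  rw [hsplit] at key1
  have hck : (0 : ℝ) < (c : ℝ) ^ k := by positivity
  have key2 : κ * (c : ℝ) ^ θ ≤ ((k : ℝ) + 1) * R := by
    have : (c : ℝ) ^ k * (κ * (c : ℝ) ^ θ) ≤ (c : ℝ) ^ k * (((k : ℝ) + 1) * R) := by
      calc (c : ℝ) ^ k * (κ * (c : ℝ) ^ θ) = κ * ((c : ℝ) ^ k * (c : ℝ) ^ θ) := by ring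
        _ ≤ ((k : ℝ) + 1) * (c : ℝ) ^ k * R := key1
        _ = (c : ℝ) ^ k * (((k : ℝ) + 1) * R) := by ring
    exact le_of_mul_le_mul_left this hck
  have key3 : (c : ℝ) ^ θ ≤ ((k : ℝ) + 1) / κ * R := by
    rw [div_mul_eq_mul_div, le_div_iff₀ hκ]; linarith [key2]
  have key4 := le_rpow_one_div_of_rpow_le hθ hc0.le key3
  rwa [Real.mul_rpow (by positivity) hR.le] at key4

/-- **`CycloRadOdd n` implies abc** (`n ≥ 1`): the parity-restricted lower bound suffices.
[folklore] -/
theorem abc_of_cycloRadOdd {n : ℕ} (hn : 1 ≤ n) (H : CycloRadOdd n) : ABC := by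
  obtain ⟨k, rfl⟩ : ∃ k, n = k + 1 := ⟨n - 1, by omega⟩
  rw [ABC_iff]
  intro ε hε
  set θ : ℝ := 1 / (1 + ε) with hθdef
  have hθ0 : 0 < θ := by positivity
  have hθ1 : θ < 1 := by rw [hθdef, div_lt_one (by positivity)]; linarith
  obtain ⟨κ, hκ, Hκ⟩ := H (1 - θ) (by linarith)
  have H' : ∀ u v : ℕ, 0 < u → u < v → Nat.Coprime u v → Odd (u + v) →
      κ * (v : ℝ) ^ ((k : ℝ) + θ) ≤ ((radical (u * v * (v ^ (k + 1) - u ^ (k + 1))) : ℕ) : ℝ) := by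
    intro u v hu huv hc ho
    have := Hκ u v hu huv hc ho
    rwa [show ((k + 1 : ℕ) : ℝ) - (1 - θ) = (k : ℝ) + θ by push_cast; ring] at this
  obtain ⟨C, hC, HC⟩ := polyABC_of_eval k hθ0 hκ (fun a b c h => abc_eval_odd k H' h)
  have hinv : 1 / θ = 1 + ε := by rw [hθdef, one_div_one_div]
  refine ⟨C + 1, by positivity, ?_⟩
  intro a b c h
  have hR := rad_cast_pos h
  have h1 := HC a b c h
  rw [hinv] at h1
  have hpow : (0 : ℝ) < ((rad a b c : ℕ) : ℝ) ^ (1 + ε) := Real.rpow_pos_of_pos hR _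
  calc (c : ℝ) ≤ C * ((rad a b c : ℕ) : ℝ) ^ (1 + ε) := h1
    _ < (C + 1) * ((rad a b c : ℕ) : ℝ) ^ (1 + ε) := by nlinarith

/-- `CycloRad n → CycloRadOdd n` (drop the pairs of equal parity). [folklore] -/
theorem cycloRadOdd_of_cycloRad {n : ℕ} (H : CycloRad n) : CycloRadOdd n := by
  intro ε hε
  obtain ⟨κ, hκ, Hκ⟩ := H ε hε
  exact ⟨κ, hκ, fun u v hu huv hc _ => Hκ u v hu huv hc⟩

/-- **`ABC ↔ CycloRadOdd n`** for every `n ≥ 1`. [folklore] -/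
theorem abc_iff_cycloRadOdd {n : ℕ} (hn : 1 ≤ n) : ABC ↔ CycloRadOdd n :=
  ⟨fun h => cycloRadOdd_of_cycloRad (cycloRad_of_abc h hn), abc_of_cycloRadOdd hn⟩

/-! ### Real-analysis helper: extracting the exponent -/

/-- From `v^n < C · ρ^{1+δ}` with `δ = ε/n` to `(1/C)^{1/(1+δ)} · v^{n−ε} ≤ ρ`. [folklore] -/
theorem rpow_sub_le_of_pow_lt {n : ℕ} (hn : 1 ≤ n) {v ρ C ε : ℝ} (hv : 1 ≤ v) (hρ : 0 ≤ ρ)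
    (hC : 0 < C) (hε : 0 < ε) (h : v ^ n < C * ρ ^ (1 + ε / n)) :
    (1 / C) ^ (1 / (1 + ε / n)) * v ^ ((n : ℝ) - ε) ≤ ρ := by
  have hn0 : (0 : ℝ) < n := by exact_mod_cast (show 0 < n by omega)
  set δ : ℝ := ε / n with hδdef
  have hδ : 0 < δ := by positivity
  have hv0 : 0 < v := by linarith
  have h1 : v ^ n / C < ρ ^ (1 + δ) := by
    rw [div_lt_iff₀ hC]; linarith [h]
  have h2 : (v ^ n / C) ^ (1 / (1 + δ)) < ρ := by
    have := Real.rpow_lt_rpow (by positivity) h1 (by positivity : (0 : ℝ) < 1 / (1 + δ))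
    rwa [← Real.rpow_mul hρ, show (1 + δ) * (1 / (1 + δ)) = 1 by field_simp,
      Real.rpow_one] at this
  have h3 : (v ^ n / C) ^ (1 / (1 + δ)) = (1 / C) ^ (1 / (1 + δ)) * v ^ ((n : ℝ) / (1 + δ)) := by
    rw [div_eq_mul_one_div (v ^ n) C, mul_comm (v ^ n),
      Real.mul_rpow (by positivity) (by positivity), ← Real.rpow_natCast,
      ← Real.rpow_mul hv0.le, mul_one_div]
  have hexp : (n : ℝ) - ε ≤ (n : ℝ) / (1 + δ) := by
    rw [le_div_iff₀ (by positivity)]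
    have hnd : (n : ℝ) * δ = ε := by rw [hδdef]; field_simp
    nlinarith [mul_pos hε hδ]
  have h4 : v ^ ((n : ℝ) - ε) ≤ v ^ ((n : ℝ) / (1 + δ)) :=
    Real.rpow_le_rpow_of_exponent_le hv hexp
  calc (1 / C) ^ (1 / (1 + δ)) * v ^ ((n : ℝ) - ε)
      ≤ (1 / C) ^ (1 / (1 + δ)) * v ^ ((n : ℝ) / (1 + δ)) :=
        mul_le_mul_of_nonneg_left h4 (by positivity)
    _ = (v ^ n / C) ^ (1 / (1 + δ)) := h3.symm
    _ ≤ ρ := h2.le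

/-! ### The Pythagorean triple of squares over a coprime pair of opposite parity -/

/-- Arithmetic of the Pythagorean parametrisation in `ℕ`: with `d = v² − u²` (`u ≤ v`),
`d² + (2uv)² = (v² + u²)²` and `d · (v² + u²) = v⁴ − u⁴`. [folklore] -/
theorem pythagorean_param (u v : ℕ) (huv : u ≤ v) :
    (v ^ 2 - u ^ 2) ^ 2 + (2 * u * v) ^ 2 = (v ^ 2 + u ^ 2) ^ 2 ∧
      (v ^ 2 - u ^ 2) * (v ^ 2 + u ^ 2) = v ^ 4 - u ^ 4 := by
  have hsq : u ^ 2 ≤ v ^ 2 := Nat.pow_le_pow_left huv 2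
  obtain ⟨d, hd⟩ := Nat.exists_eq_add_of_le hsq
  have hd' : v ^ 2 - u ^ 2 = d := by omega
  have h4 : v ^ 4 = (u ^ 2 + d) ^ 2 := by rw [← hd]; ring
  refine ⟨?_, ?_⟩
  · rw [hd', show (2 * u * v) ^ 2 = 4 * u ^ 2 * v ^ 2 by ring, hd]; ring
  · rw [hd', h4, hd]
    have : (u ^ 2 + d) ^ 2 = d * (u ^ 2 + d + u ^ 2) + u ^ 4 := by ring
    rw [this, Nat.add_sub_cancel]

/-- For coprime `u < v` of opposite parity, `((v² − u²)², (2uv)², (v² + u²)²)` is an abc triple.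
[folklore] -/
theorem pythagorean_isABCTriple {u v : ℕ} (hu : 0 < u) (huv : u < v) (hcop : Nat.Coprime u v)
    (hodd : Odd (u + v)) :
    IsABCTriple ((v ^ 2 - u ^ 2) ^ 2) ((2 * u * v) ^ 2) ((v ^ 2 + u ^ 2) ^ 2) := by
  have hsq : u ^ 2 < v ^ 2 := Nat.pow_lt_pow_left huv (by norm_num)
  have hv : 0 < v := by omega
  refine ⟨pow_pos (by omega) 2, by positivity, (pythagorean_param u v huv.le).1, ?_⟩
  apply Nat.Coprime.pow
  -- `Coprime (v² − u²) (2 · u · v)`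
  have h2 : Nat.Coprime (v ^ 2 - u ^ 2) 2 := by
    rw [Nat.coprime_two_right, Nat.odd_sub' hsq.le, Nat.odd_pow_iff (by norm_num : 2 ≠ 0),
      Nat.even_pow' (by norm_num : 2 ≠ 0)]
    exact (Nat.odd_add.mp hodd)
  have hu' : Nat.Coprime (v ^ 2 - u ^ 2) u := by
    have h1 : Nat.Coprime (v ^ 2 - u ^ 2) (u ^ 2) := by
      rw [← Nat.coprime_add_self_left, Nat.sub_add_cancel hsq.le]
      exact Nat.Coprime.pow 2 2 hcop.symm
    exact h1.coprime_dvd_right (dvd_pow_self u (by norm_num))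
  have hv' : Nat.Coprime (v ^ 2 - u ^ 2) v := by
    have h1 : Nat.Coprime (v ^ 2 - u ^ 2) (v ^ 2) := by
      rw [Nat.coprime_self_sub_left hsq.le]
      exact Nat.Coprime.pow 2 2 hcop
    exact h1.coprime_dvd_right (dvd_pow_self v (by norm_num))
  simpa [mul_assoc] using (h2.mul_right hu').mul_right hv'

/-- The radical of the Pythagorean triple of squares is at most `2 · rad(u v (v⁴ − u⁴))`.
[folklore] -/
theorem pythagorean_rad_le {u v : ℕ} (hu : 0 < u) (huv : u < v) :
    rad ((v ^ 2 - u ^ 2) ^ 2) ((2 * u * v) ^ 2) ((v ^ 2 + u ^ 2) ^ 2)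
      ≤ 2 * radical (u * v * (v ^ 4 - u ^ 4)) := by
  have h44 : u ^ 4 < v ^ 4 := Nat.pow_lt_pow_left huv (by norm_num)
  have hprod : (v ^ 2 - u ^ 2) ^ 2 * (2 * u * v) ^ 2 * (v ^ 2 + u ^ 2) ^ 2
      = (2 * (u * v * (v ^ 4 - u ^ 4))) ^ 2 := by
    rw [← (pythagorean_param u v huv.le).2]; ring
  rw [rad_def, hprod, radical_pow _ (by norm_num : 2 ≠ 0)]
  have hm : 0 < u * v * (v ^ 4 - u ^ 4) := by
    have : 0 < v ^ 4 - u ^ 4 := by omega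
    have hv : 0 < v := by omega
    positivity
  have hdvd : radical (2 * (u * v * (v ^ 4 - u ^ 4))) ∣ 2 * radical (u * v * (v ^ 4 - u ^ 4)) :=
    radical_mul_dvd.trans (mul_dvd_mul radical_dvd_self dvd_rfl)
  exact Nat.le_of_dvd (by positivity [Nat.pos_of_ne_zero (radical_ne_zero (a := u * v * (v ^ 4 - u ^ 4)))]) hdvd

/-! ### abc on squares `→ CycloRadOdd 4 → ABC` -/

/-- **abc on triples of squares implies `CycloRadOdd 4`.** [folklore] -/
theorem cycloRadOdd_four_of_abcOnSquares (habc : Literature.Uncategorized.ABCOnSquares) : CycloRadOdd 4 := by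
  intro ε hε
  obtain ⟨C, hC, H⟩ := habc (ε / 4) (by positivity)
  have hC2 : (0 : ℝ) < C * (2 : ℝ) ^ (1 + ε / 4) := by positivity
  refine ⟨(1 / (C * (2 : ℝ) ^ (1 + ε / 4))) ^ (1 / (1 + ε / (4 : ℕ))), by positivity, ?_⟩
  intro u v hu huv hcop hodd
  have hv : 0 < v := by omega
  have hT := pythagorean_isABCTriple hu huv hcop hodd
  have hH := H _ _ _ hT ⟨v ^ 2 - u ^ 2, rfl⟩ ⟨2 * u * v, rfl⟩ ⟨v ^ 2 + u ^ 2, rfl⟩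
  set ρ : ℝ := ((radical (u * v * (v ^ 4 - u ^ 4)) : ℕ) : ℝ) with hρdef
  have hρ0 : 0 ≤ ρ := Nat.cast_nonneg _
  have hrad : ((rad ((v ^ 2 - u ^ 2) ^ 2) ((2 * u * v) ^ 2) ((v ^ 2 + u ^ 2) ^ 2) : ℕ) : ℝ)
      ≤ 2 * ρ := by
    rw [hρdef]; exact_mod_cast pythagorean_rad_le hu huv
  have hradnn : (0 : ℝ) ≤ ((rad ((v ^ 2 - u ^ 2) ^ 2) ((2 * u * v) ^ 2) ((v ^ 2 + u ^ 2) ^ 2) : ℕ) : ℝ) :=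
    Nat.cast_nonneg _
  -- size of the largest member
  have hsize : ((v : ℝ)) ^ 4 ≤ ((((v ^ 2 + u ^ 2) ^ 2 : ℕ)) : ℝ) := by
    have : v ^ 4 ≤ (v ^ 2 + u ^ 2) ^ 2 := by
      calc v ^ 4 = (v ^ 2) ^ 2 := by ring
        _ ≤ (v ^ 2 + u ^ 2) ^ 2 := Nat.pow_le_pow_left (Nat.le_add_right _ _) 2
    exact_mod_cast this
  -- chain: v^4 ≤ c < C rad^{1+δ} ≤ C (2ρ)^{1+δ} = (C 2^{1+δ}) ρ^{1+δ}
  have hmono : ((rad ((v ^ 2 - u ^ 2) ^ 2) ((2 * u * v) ^ 2) ((v ^ 2 + u ^ 2) ^ 2) : ℕ) : ℝ)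
      ^ (1 + ε / 4) ≤ (2 * ρ) ^ (1 + ε / 4) :=
    Real.rpow_le_rpow hradnn hrad (by positivity)
  have hlt : (v : ℝ) ^ 4 < (C * (2 : ℝ) ^ (1 + ε / 4)) * ρ ^ (1 + ε / (4 : ℕ)) := by
    calc (v : ℝ) ^ 4 ≤ ((((v ^ 2 + u ^ 2) ^ 2 : ℕ)) : ℝ) := hsize
      _ < C * ((rad ((v ^ 2 - u ^ 2) ^ 2) ((2 * u * v) ^ 2) ((v ^ 2 + u ^ 2) ^ 2) : ℕ) : ℝ)
            ^ (1 + ε / 4) := hH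
      _ ≤ C * (2 * ρ) ^ (1 + ε / 4) := mul_le_mul_of_nonneg_left hmono hC.le
      _ = (C * (2 : ℝ) ^ (1 + ε / 4)) * ρ ^ (1 + ε / (4 : ℕ)) := by
          rw [Real.mul_rpow (by norm_num) hρ0]; push_cast; ring
  have hv1 : (1 : ℝ) ≤ v := by exact_mod_cast hv
  have := rpow_sub_le_of_pow_lt (n := 4) (by norm_num) hv1 hρ0 hC2 hε hlt
  simpa using this

/-- `ABC` restricts to triples of squares. [folklore] -/
theorem abcOnSquares_of_abc (habc : ABC) : Literature.Uncategorized.ABCOnSquares := by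
  rw [ABC_iff] at habc
  intro ε hε
  obtain ⟨C, hC, H⟩ := habc ε hε
  exact ⟨C, hC, fun a b c h _ _ _ => H a b c h⟩

/-- **`ABC ↔ Literature.Uncategorized.ABCOnSquares`**: the abc conjecture is equivalent to its restriction to abc triples of
three squares (primitive Pythagorean triples). [folklore] -/
theorem abc_iff_abcOnSquares : ABC ↔ Literature.Uncategorized.ABCOnSquares :=
  ⟨abcOnSquares_of_abc,
    fun h => abc_of_cycloRadOdd (by norm_num) (cycloRadOdd_four_of_abcOnSquares h)⟩

/-! ### Powerful triples -/

/-- `ABC` restricts to powerful triples. [folklore] -/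
theorem abcOnPowerful_of_abc (habc : ABC) : Literature.Uncategorized.ABCOnPowerful := by
  rw [ABC_iff] at habc
  intro ε hε
  obtain ⟨C, hC, H⟩ := habc ε hε
  exact ⟨C, hC, fun a b c h _ _ _ => H a b c h⟩

/-- abc on powerful triples implies abc on triples of squares (squares are powerful). [folklore] -/
theorem abcOnSquares_of_abcOnPowerful (h : Literature.Uncategorized.ABCOnPowerful) : Literature.Uncategorized.ABCOnSquares := by
  intro ε hε
  obtain ⟨C, hC, H⟩ := h ε hε
  refine ⟨C, hC, fun a b c ht ⟨x, hx⟩ ⟨y, hy⟩ ⟨z, hz⟩ => H a b c ht ?_ ?_ ?_⟩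
  · rw [hx]; exact isPowerful_pow 2 x
  · rw [hy]; exact isPowerful_pow 2 y
  · rw [hz]; exact isPowerful_pow 2 z

/-- **`ABC ↔ Literature.Uncategorized.ABCOnPowerful`**: the abc conjecture is equivalent to its restriction to abc triples
`a + b = c` in which `a`, `b`, `c` are all powerful numbers. [folklore] -/
theorem abc_iff_abcOnPowerful : ABC ↔ Literature.Uncategorized.ABCOnPowerful :=
  ⟨abcOnPowerful_of_abc,
    fun h => abc_iff_abcOnSquares.mpr (abcOnSquares_of_abcOnPowerful h)⟩

/-! ### Pythagorean phrasing -/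

/-- **abc ↔ abc for Pythagorean triples**: `ABC` holds iff for every `ε > 0` there is `C > 0` with
`z² < C · rad(x y z)^{1+ε}` for all coprime positive `x, y, z` with `x² + y² = z²`. [folklore] -/
theorem abc_iff_pythagorean :
    ABC ↔ ∀ ε : ℝ, 0 < ε → ∃ C : ℝ, 0 < C ∧ ∀ x y z : ℕ, 0 < x → 0 < y → x ^ 2 + y ^ 2 = z ^ 2 →
      Nat.Coprime x y → ((z : ℝ)) ^ 2 < C * ((radical (x * y * z) : ℕ) : ℝ) ^ (1 + ε) := by
  rw [abc_iff_abcOnSquares]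
  have hrad : ∀ x y z : ℕ, rad (x ^ 2) (y ^ 2) (z ^ 2) = radical (x * y * z) := by
    intro x y z
    rw [rad_def, show x ^ 2 * y ^ 2 * z ^ 2 = (x * y * z) ^ 2 by ring,
      radical_pow _ (by norm_num : 2 ≠ 0)]
  constructor
  · intro h ε hε
    obtain ⟨C, hC, H⟩ := h ε hε
    refine ⟨C, hC, fun x y z hx hy hxyz hcop => ?_⟩
    have hT : IsABCTriple (x ^ 2) (y ^ 2) (z ^ 2) :=
      ⟨by positivity, by positivity, hxyz, Nat.Coprime.pow 2 2 hcop⟩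
    have := H _ _ _ hT ⟨x, rfl⟩ ⟨y, rfl⟩ ⟨z, rfl⟩
    rw [hrad] at this
    exact_mod_cast this
  · intro h ε hε
    obtain ⟨C, hC, H⟩ := h ε hε
    refine ⟨C, hC, ?_⟩
    rintro a b c ⟨ha, hb, habc, hcop⟩ ⟨x, rfl⟩ ⟨y, rfl⟩ ⟨z, rfl⟩
    have hx : 0 < x := Nat.pos_of_ne_zero (by rintro rfl; simp at ha)
    have hy : 0 < y := Nat.pos_of_ne_zero (by rintro rfl; simp at hb)
    have hcop' : Nat.Coprime x y :=
      (Nat.coprime_pow_left_iff two_pos _ _).mp ((Nat.coprime_pow_right_iff two_pos _ _).mp hcop)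
    have := H x y z hx hy habc hcop'
    rw [hrad]
    push_cast
    exact this

end Summit.ABC.ABC.Theorems

end
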